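import Summits.QuantumFields.YangMills.Theorems.FluctuationComparisonRegPrIntLTailSupOneConvexTailBox
import HarnessLib

/-!
# `FluctuationComparisonRegPrIntLTailSupOneConvexTailEta` — LINE g21-2 «DEPTH-ONE WINDOW ODDS BY A MEASURE SPLIT»: THE η-CENTRING EDITIONS OF THE CONVEX
# WINDOW-ODDS ENGINES (whole space ✓`…TailSupOneConvexTail`, box ∕ convex set ∕ `StrongConvexOn` ✓`…TailSupOneConvexTailBox`)
# (crux `UnitScaleTilt.FluctuationComparisonRegPrIntL`, stmt-QuantumFields-20520; rows MOD₁ ∕ MOD₁∘ of `Cruxes/…/Lines/tailsup_one.lean`, ideator ym-r3-idea-1 g21)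

Cell `ym3-torus` (YM ladder rung R3 = continuum SU(2) Yang–Mills on T³ — a RUNG, NOT the Clay problem: not d = 4, not infinite volume, not a mass gap);
width seat `ym3-torus-px20` (gen 10); helper `--supports stmt-QuantumFields-20520`.  THEOREMS ONLY (0 `def`, 0 `sorry`, default heartbeats).

WHY.  The landed centred rows (`convex_maxTail_of_centred`, `convex_maxTail_box_of_centred`, `convex_maxTail_convexSet_of_centred`, the `convexWindowOdds_*` family)
centre at HALF the threshold: means `|∫G_p dν| ≤ g·t∕2` ⇒ uncentred odds `≤ 2·#s·exp(−m t²∕(8L²))`.  The line owner's reading of the instrument row R3-FLIN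
(ideator g21, 2026-08-30 02:51Z, pointer (G)): on the FULL window the one-step minimiser's fine plaquettes sit at `(1 − η)·θ` with `η` SMALL at the smallest blocks
(`L = 3, 5`), not at `θ∕2` — so a MOD₁∘ hand «should centre at `(1 − η)θ` with tail budget `2·#s·e^{−(ηθ)²∕(2c)}` (η free) rather than `θ∕2`, or pay the halved
fraction».  This file is that edition, for all four laws, with the profile rows in ✓D's shape at `m ↦ m·η²` so the super-polynomial modulus still comes BY NAME.
* §0 ★`maxTail_le_of_centred_frac` — GENERIC (any measurable space, any measure): `|m_p| ≤ (1 − η)·T` (`p ∈ s`) ⇒ `{∃ p, T ≤ |G_p|} ⊆ {∃ p, η·T ≤ |G_p − m_p|}`, hence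
  any bound on the centred max-tail at `η·T` bounds the uncentred one at `T`.
* §1 ★`convex_maxTail_of_centred_frac` (whole space, ✓F) ∕ ★`convex_maxTail_box_of_centred_frac` ∕ ★`convex_maxTail_convexSet_of_centred_frac` ∕
  ★`convex_maxTail_box_of_strongConvexOn_of_centred_frac`: action `(m∕g²)`-convex, thresholds `g·t`, `0 ≤ η`, means `≤ (1 − η)·(g·t)` ⇒
  `≤ 2·#s·exp(−m·(η·t)²∕(2L²))` (`η = ½` is the landed `exp(−m t²∕(8L²))`).
* §2 ★`convexWindowOdds_le_frac` ∕ ★`convexWindowOdds_box_le_frac` ∕ ★`convexWindowOdds_convexSet_le_frac` ∕ ★`convexWindowOdds_box_le_of_strongConvexOn_frac`: thresholds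
  `θBal L γ b₀ p₀ i = g_i·p(g_i)`, means `≤ (1 − η)·θ_i` ⇒ `≤ 2·#s·exp(−(m·η²)·pFun b₀ p₀ g_i²∕(2L²))` — ✓`…TailSupOneGaussianTail.gaussianWindowOdds_le`'s shape at
  `m ↦ m·η²`, `R² ↦ L²`, so ✓`gaussianWindowOdds_levelSum_le` ∕ ✓`gaussianWindowOdds_superpoly` apply BY NAME for every fixed `η > 0`.
HONEST SCOPE.  One triangle inequality per row over landed engines; MOD₁∕MOD₁∘'s obligations (chart, convexity, centring at `(1 − η)θ`, gradient) are NOT touched;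
MOD₁, MOD₁∘, FAR₁, TAILSUP₁, LFR♯ᶜ, S2β, 20520, `YM3TorusSU2` NOT proved; the Yang–Mills mass gap is NOT proved.
References: [BobkovLedoux2000] Prop. 3.1 p. 1034, remark p. 1038; [BakryGentilLedoux2014] Prop. 5.4.1; [Balaban1985UV3] (7) p. 257, (38)–(41) p. 266;
[Balaban1985Variational] Thm 1 (9)–(10) p. 279 (the minimiser's position inside the window).
-/

noncomputable section

set_option autoImplicit false

open MeasureTheory ProbabilityTheory Filter Topology Set
open scoped RealInnerProductSpace ENNReal NNReal BigOperators
open Literature.MathematicalPhysics.QuantumFieldTheory.Balaban1983to89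
open Literature.MathematicalPhysics.QuantumFieldTheory.Balaban1983to89.T3ContinuumYM3Torus
open Literature.MathematicalPhysics.QuantumFieldTheory.Balaban1983to89.T3UnitScaleTilt
open Summit.QuantumFields.YangMills.Theorems.FluctuationComparisonRegPrIntLTailSupOneConvexTail
  (convex_maxTail_coupling_cancels)
open Summit.QuantumFields.YangMills.Theorems.FluctuationComparisonRegPrIntLTailSupOneConvexTailBox
  (convex_maxTail_box_coupling_cancels convex_maxTail_convexSet convex_maxTail_box_of_strongConvexOn coupling_pos_and_pFun_nonneg)

namespace Summit.QuantumFields.YangMills.Theorems.FluctuationComparisonRegPrIntLTailSupOneConvexTailEta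

/-! ## §0 Generic: centring at a fraction of the threshold -/

section Generic

variable {Ω : Type*} [MeasurableSpace Ω]

/-- ★ **CENTRING AT `(1 − η)·T`**: if `|m_p| ≤ (1 − η)·T` for `p ∈ s`, then `{∃ p ∈ s, T ≤ |G_p|} ⊆ {∃ p ∈ s, η·T ≤ |G_p − m_p|}` (`|G − m| ≥ |G| − |m|`), so every bound
`B` on the centred max-tail at `η·T` bounds the uncentred max-tail at `T` (finite measure, for monotonicity in `ℝ`). [folklore] -/
theorem maxTail_le_of_centred_frac (ν : Measure Ω) [IsFiniteMeasure ν] {A : Type*} (s : Finset A) (G : A → Ω → ℝ) (m : A → ℝ)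
    {T η B : ℝ} (hmean : ∀ p ∈ s, |m p| ≤ (1 - η) * T)
    (htail : ν.real {x | ∃ p ∈ s, η * T ≤ |G p x - m p|} ≤ B) :
    ν.real {x | ∃ p ∈ s, T ≤ |G p x|} ≤ B := by
  have hsub : {x | ∃ p ∈ s, T ≤ |G p x|} ⊆ {x | ∃ p ∈ s, η * T ≤ |G p x - m p|} := by
    rintro x ⟨p, hp, hx⟩
    refine ⟨p, hp, ?_⟩
    have h1 : |G p x| - |m p| ≤ |G p x - m p| := abs_sub_abs_le_abs_sub _ _
    have h2 := hmean p hp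
    nlinarith
  exact (measureReal_mono hsub).trans htail

end Generic

variable {n : ℕ}

/-! ## §1 The four laws: thresholds `g·t`, means `≤ (1 − η)·(g·t)`, bound `2·#s·exp(−m·(η·t)²∕(2L²))` -/

section Laws

variable {V : EuclideanSpace ℝ (Fin n) → ℝ} {W : EuclideanSpace ℝ (Fin n) → EuclideanSpace ℝ (Fin n)}

/-- ★ **WHOLE SPACE, η-CENTRED**: `V` `(m∕g²)`-uniformly convex on `ℝⁿ` (first-order letter with `gradient V`), bounded `C¹` observables with `‖DG_p‖ ≤ L`, thresholds `g·t`
(`t ≥ 0`), `η ≥ 0`, means `|∫G_p dν| ≤ (1 − η)·(g·t)` under `ν = volume.tilted (−V)` ⇒ `ν.real{∃ p ∈ s, g·t ≤ |G_p|} ≤ 2·#s·exp(−m·(η·t)²∕(2L²))`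
(✓F `convex_maxTail_coupling_cancels` at threshold `η·t` + §0). [cite: BakryGentilLedoux2014, Prop. 5.4.1; Balaban1985UV3, (38)-(41) p.266] -/
theorem convex_maxTail_of_centred_frac {m g : ℝ} (hm : 0 < m) (hg : 0 < g) (hVc : Continuous V)
    (hV : ∀ x y : EuclideanSpace ℝ (Fin n), V x + ⟪gradient V x, y - x⟫ + (m / g ^ 2) / 2 * ‖y - x‖ ^ 2 ≤ V y)
    (hZ : Integrable fun x => Real.exp (-V x))
    {A : Type*} (s : Finset A) (G : A → EuclideanSpace ℝ (Fin n) → ℝ) (B : A → ℝ) {L : ℝ} (hL : 0 < L)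
    (hG : ∀ p ∈ s, ContDiff ℝ 1 (G p)) (hGb : ∀ p ∈ s, ∀ x, |G p x| ≤ B p) (hGD : ∀ p ∈ s, ∀ x, ‖fderiv ℝ (G p) x‖ ≤ L)
    {t η : ℝ} (ht : 0 ≤ t) (hη : 0 ≤ η)
    (hmean : ∀ p ∈ s, |∫ z, G p z ∂((volume : Measure (EuclideanSpace ℝ (Fin n))).tilted fun x => -V x)| ≤ (1 - η) * (g * t)) :
    ((volume : Measure (EuclideanSpace ℝ (Fin n))).tilted fun x => -V x).real {x | ∃ p ∈ s, g * t ≤ |G p x|} ≤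
      2 * s.card * Real.exp (-(m * (η * t) ^ 2 / (2 * L ^ 2))) := by
  haveI : IsProbabilityMeasure ((volume : Measure (EuclideanSpace ℝ (Fin n))).tilted fun x => -V x) :=
    Literature.Analysis.FunctionSpaces.isProbabilityMeasure_tilted_neg hZ
  have h := convex_maxTail_coupling_cancels hm hg hVc hV hZ s G B hL hG hGb hGD (t := η * t) (mul_nonneg hη ht)
  refine maxTail_le_of_centred_frac _ s G _ hmean ?_
  have e : η * (g * t) = g * (η * t) := by ring
  rw [e]
  exact h

variable {Ωs : Set (EuclideanSpace ℝ (Fin n))}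

/-- ★ **BOX LAW, η-CENTRED**: `Ω` open convex of positive volume, `V` continuous on `Ω` and `(m∕g²)`-convex ON `Ω` (first-order letter, any field `W`), `e^{−V}` integrable on `Ω`;
thresholds `g·t`, `η ≥ 0`, means `≤ (1 − η)·(g·t)` under `ν_Ω = (volume.restrict Ω).tilted (−V)` ⇒ `ν_Ω.real{∃ p ∈ s, g·t ≤ |G_p|} ≤ 2·#s·exp(−m·(η·t)²∕(2L²))`
(✓`convex_maxTail_box_coupling_cancels` at `η·t` + §0). [cite: BobkovLedoux2000, Prop. 3.1 p. 1034; Balaban1985UV3, (38)-(41) p.266] -/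
theorem convex_maxTail_box_of_centred_frac (hΩo : IsOpen Ωs) (hΩc : Convex ℝ Ωs) (hΩ0 : volume Ωs ≠ 0) {m g : ℝ} (hm : 0 < m) (hg : 0 < g)
    (hVc : ContinuousOn V Ωs) (hV : ∀ x ∈ Ωs, ∀ y ∈ Ωs, V x + ⟪W x, y - x⟫ + (m / g ^ 2) / 2 * ‖y - x‖ ^ 2 ≤ V y)
    (hZ : IntegrableOn (fun x => Real.exp (-V x)) Ωs)
    {A : Type*} (s : Finset A) (G : A → EuclideanSpace ℝ (Fin n) → ℝ) (B : A → ℝ) {L : ℝ} (hL : 0 < L)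
    (hG : ∀ p ∈ s, ContDiff ℝ 1 (G p)) (hGb : ∀ p ∈ s, ∀ x, |G p x| ≤ B p) (hGD : ∀ p ∈ s, ∀ x, ‖fderiv ℝ (G p) x‖ ≤ L)
    {t η : ℝ} (ht : 0 ≤ t) (hη : 0 ≤ η)
    (hmean : ∀ p ∈ s, |∫ z, G p z ∂((volume.restrict Ωs).tilted fun x => -V x)| ≤ (1 - η) * (g * t)) :
    ((volume.restrict Ωs).tilted fun x => -V x).real {x | ∃ p ∈ s, g * t ≤ |G p x|} ≤
      2 * s.card * Real.exp (-(m * (η * t) ^ 2 / (2 * L ^ 2))) := by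
  haveI : IsProbabilityMeasure ((volume.restrict Ωs).tilted fun x => -V x) :=
    YMDAG.N14.ConvexFibreBox.isProbabilityMeasure_restrict_tilted hΩ0 hZ
  have h := convex_maxTail_box_coupling_cancels hΩo hΩc hΩ0 hm hg hVc hV hZ s G B hL hG hGb hGD (t := η * t) (mul_nonneg hη ht)
  refine maxTail_le_of_centred_frac _ s G _ hmean ?_
  have e : η * (g * t) = g * (η * t) := by ring
  rw [e]
  exact h

variable {Bx : Set (EuclideanSpace ℝ (Fin n))}

/-- ★ **CONDITIONED LAW, η-CENTRED**: `V` continuous and `(m∕g²)`-convex on the whole space (first-order letter, any field `W`), `e^{−V}` integrable, `Bx` convex with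
`volume Bx ≠ 0`; thresholds `g·t`, `η ≥ 0`, means `≤ (1 − η)·(g·t)` under `ν_B = (volume.restrict Bx).tilted (−V)` ⇒ `ν_B.real{∃ p ∈ s, g·t ≤ |G_p|} ≤ 2·#s·exp(−m·(η·t)²∕(2L²))`
(✓`convex_maxTail_convexSet` at `λ = m∕g²`, threshold `g·(η·t)` + §0). [cite: BobkovLedoux2000, remark p. 1038; Balaban1985UV3, (38)-(41) p.266] -/
theorem convex_maxTail_convexSet_of_centred_frac (hB : Convex ℝ Bx) (hB0 : volume Bx ≠ 0) {m g : ℝ} (hm : 0 < m) (hg : 0 < g) (hVc : Continuous V)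
    (hV : ∀ x y : EuclideanSpace ℝ (Fin n), V x + ⟪W x, y - x⟫ + (m / g ^ 2) / 2 * ‖y - x‖ ^ 2 ≤ V y)
    (hZ : Integrable fun x => Real.exp (-V x))
    {A : Type*} (s : Finset A) (G : A → EuclideanSpace ℝ (Fin n) → ℝ) (B : A → ℝ) {L : ℝ} (hL : 0 < L)
    (hG : ∀ p ∈ s, ContDiff ℝ 1 (G p)) (hGb : ∀ p ∈ s, ∀ x, |G p x| ≤ B p) (hGD : ∀ p ∈ s, ∀ x, ‖fderiv ℝ (G p) x‖ ≤ L)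
    {t η : ℝ} (ht : 0 ≤ t) (hη : 0 ≤ η)
    (hmean : ∀ p ∈ s, |∫ z, G p z ∂((volume.restrict Bx).tilted fun x => -V x)| ≤ (1 - η) * (g * t)) :
    ((volume.restrict Bx).tilted fun x => -V x).real {x | ∃ p ∈ s, g * t ≤ |G p x|} ≤
      2 * s.card * Real.exp (-(m * (η * t) ^ 2 / (2 * L ^ 2))) := by
  haveI : IsProbabilityMeasure ((volume.restrict Bx).tilted fun x => -V x) :=
    YMDAG.N14.ConvexFibreBox.isProbabilityMeasure_restrict_tilted hB0 hZ.integrableOn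
  have h := convex_maxTail_convexSet hB hB0 (div_pos hm (pow_pos hg 2)) hVc hV hZ s G B hL hG hGb hGD (t := g * (η * t)) (by positivity)
  have hexp : -(m / g ^ 2 * (g * (η * t)) ^ 2 / (2 * L ^ 2)) = -(m * (η * t) ^ 2 / (2 * L ^ 2)) := by
    field_simp
  rw [hexp] at h
  refine maxTail_le_of_centred_frac _ s G _ hmean ?_
  have e : η * (g * t) = g * (η * t) := by ring
  rw [e]
  exact h

/-- ★ **BOX LAW IN `StrongConvexOn` CURRENCY, η-CENTRED**: `StrongConvexOn Ω (m∕g²) V` + `ContinuousOn V Ω` in place of the first-order letter; thresholds `g·t`, `η ≥ 0`,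
means `≤ (1 − η)·(g·t)` ⇒ `≤ 2·#s·exp(−m·(η·t)²∕(2L²))` (✓`convex_maxTail_box_of_strongConvexOn` at `λ = m∕g²`, threshold `g·(η·t)` + §0).
[cite: BobkovLedoux2000, Prop. 3.1 p. 1034; Balaban1985UV3, (38)-(41) p.266] -/
theorem convex_maxTail_box_of_strongConvexOn_of_centred_frac (hΩo : IsOpen Ωs) (hΩc : Convex ℝ Ωs) (hΩ0 : volume Ωs ≠ 0) {m g : ℝ} (hm : 0 < m)
    (hg : 0 < g) (hVs : StrongConvexOn Ωs (m / g ^ 2) V) (hVc : ContinuousOn V Ωs) (hZ : IntegrableOn (fun x => Real.exp (-V x)) Ωs)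
    {A : Type*} (s : Finset A) (G : A → EuclideanSpace ℝ (Fin n) → ℝ) (B : A → ℝ) {L : ℝ} (hL : 0 < L)
    (hG : ∀ p ∈ s, ContDiff ℝ 1 (G p)) (hGb : ∀ p ∈ s, ∀ x, |G p x| ≤ B p) (hGD : ∀ p ∈ s, ∀ x, ‖fderiv ℝ (G p) x‖ ≤ L)
    {t η : ℝ} (ht : 0 ≤ t) (hη : 0 ≤ η)
    (hmean : ∀ p ∈ s, |∫ z, G p z ∂((volume.restrict Ωs).tilted fun x => -V x)| ≤ (1 - η) * (g * t)) :
    ((volume.restrict Ωs).tilted fun x => -V x).real {x | ∃ p ∈ s, g * t ≤ |G p x|} ≤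
      2 * s.card * Real.exp (-(m * (η * t) ^ 2 / (2 * L ^ 2))) := by
  haveI : IsProbabilityMeasure ((volume.restrict Ωs).tilted fun x => -V x) :=
    YMDAG.N14.ConvexFibreBox.isProbabilityMeasure_restrict_tilted hΩ0 hZ
  have h := convex_maxTail_box_of_strongConvexOn hΩo hΩc hΩ0 (div_pos hm (pow_pos hg 2)) hVs hVc hZ s G B hL hG hGb hGD
    (t := g * (η * t)) (by positivity)
  have hexp : -(m / g ^ 2 * (g * (η * t)) ^ 2 / (2 * L ^ 2)) = -(m * (η * t) ^ 2 / (2 * L ^ 2)) := by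
    field_simp
  rw [hexp] at h
  refine maxTail_le_of_centred_frac _ s G _ hmean ?_
  have e : η * (g * t) = g * (η * t) := by ring
  rw [e]
  exact h

end Laws

/-! ## §2 In the tree's profile: thresholds `θBal L γ b₀ p₀ i`, means `≤ (1 − η)·θ_i`; ✓D's shape at `m ↦ m·η²` -/

section Profile

variable {V : EuclideanSpace ℝ (Fin n) → ℝ} {W : EuclideanSpace ℝ (Fin n) → EuclideanSpace ℝ (Fin n)}

/-- ★ **WHOLE-SPACE WINDOW ODDS AT LEVEL `i`, η-CENTRED**: action `(m∕g_i²)`-convex on `ℝⁿ`, `g_i = √(γL^{−i})`, observables `C¹` with gradient `≤ L`, `η ≥ 0`, means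
`≤ (1 − η)·θBal L γ b₀ p₀ i` ⇒ odds of leaving the level-`i` window `≤ 2·#s·exp(−(m·η²)·pFun b₀ p₀ g_i²∕(2L²))` — ✓`gaussianWindowOdds_le`'s shape at `m ↦ m·η²`, `R² ↦ L²`.
[cite: Balaban1985UV3, (7) p.257 and (38)-(41) p.266; BakryGentilLedoux2014, Prop. 5.4.1] -/
theorem convexWindowOdds_le_frac {m : ℝ} (hm : 0 < m) {Lfam : ℕ} (hLfam : 1 ≤ Lfam) {γ b₀ : ℝ} (hγ : 0 < γ) (hγ1 : γ ≤ 1) (hb₀ : 0 ≤ b₀)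
    (p₀ : ℝ) (i : ℕ) (hVc : Continuous V)
    (hV : ∀ x y : EuclideanSpace ℝ (Fin n),
      V x + ⟪gradient V x, y - x⟫ + (m / (Real.sqrt (γ * ((Lfam : ℝ)⁻¹) ^ i)) ^ 2) / 2 * ‖y - x‖ ^ 2 ≤ V y)
    (hZ : Integrable fun x => Real.exp (-V x))
    {A : Type*} (s : Finset A) (G : A → EuclideanSpace ℝ (Fin n) → ℝ) (B : A → ℝ) {L : ℝ} (hL : 0 < L)
    (hG : ∀ p ∈ s, ContDiff ℝ 1 (G p)) (hGb : ∀ p ∈ s, ∀ x, |G p x| ≤ B p) (hGD : ∀ p ∈ s, ∀ x, ‖fderiv ℝ (G p) x‖ ≤ L)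
    {η : ℝ} (hη : 0 ≤ η)
    (hmean : ∀ p ∈ s, |∫ z, G p z ∂((volume : Measure (EuclideanSpace ℝ (Fin n))).tilted fun x => -V x)| ≤ (1 - η) * θBal Lfam γ b₀ p₀ i) :
    ((volume : Measure (EuclideanSpace ℝ (Fin n))).tilted fun x => -V x).real {x | ∃ p ∈ s, θBal Lfam γ b₀ p₀ i ≤ |G p x|} ≤
      2 * s.card * Real.exp (-(m * η ^ 2 * B10.pFun b₀ p₀ (Real.sqrt (γ * ((Lfam : ℝ)⁻¹) ^ i)) ^ 2 / (2 * L ^ 2))) := by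
  obtain ⟨hg, hp⟩ := coupling_pos_and_pFun_nonneg hLfam hγ hγ1 hb₀ p₀ i
  have hmean' : ∀ p ∈ s, |∫ z, G p z ∂((volume : Measure (EuclideanSpace ℝ (Fin n))).tilted fun x => -V x)| ≤
      (1 - η) * (Real.sqrt (γ * ((Lfam : ℝ)⁻¹) ^ i) * B10.pFun b₀ p₀ (Real.sqrt (γ * ((Lfam : ℝ)⁻¹) ^ i))) := hmean
  have h := convex_maxTail_of_centred_frac hm hg hVc hV hZ s G B hL hG hGb hGD hp hη hmean'
  have hexp : -(m * (η * B10.pFun b₀ p₀ (Real.sqrt (γ * ((Lfam : ℝ)⁻¹) ^ i))) ^ 2 / (2 * L ^ 2)) =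
      -(m * η ^ 2 * B10.pFun b₀ p₀ (Real.sqrt (γ * ((Lfam : ℝ)⁻¹) ^ i)) ^ 2 / (2 * L ^ 2)) := by ring
  rw [hexp] at h
  exact h

/-- ★ **BOX-LAW WINDOW ODDS AT LEVEL `i`, η-CENTRED**: action `(m∕g_i²)`-convex on the open convex chart domain `Ω` (`volume Ω ≠ 0`), means `≤ (1 − η)·θ_i` under `ν_Ω` ⇒
`≤ 2·#s·exp(−(m·η²)·pFun b₀ p₀ g_i²∕(2L²))`. [cite: Balaban1985UV3, (7) p.257 and (38)-(41) p.266; BobkovLedoux2000, Prop. 3.1 p. 1034] -/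
theorem convexWindowOdds_box_le_frac {Ωs : Set (EuclideanSpace ℝ (Fin n))} (hΩo : IsOpen Ωs) (hΩc : Convex ℝ Ωs) (hΩ0 : volume Ωs ≠ 0)
    {m : ℝ} (hm : 0 < m) {Lfam : ℕ} (hLfam : 1 ≤ Lfam) {γ b₀ : ℝ} (hγ : 0 < γ) (hγ1 : γ ≤ 1) (hb₀ : 0 ≤ b₀) (p₀ : ℝ) (i : ℕ)
    (hVc : ContinuousOn V Ωs)
    (hV : ∀ x ∈ Ωs, ∀ y ∈ Ωs, V x + ⟪W x, y - x⟫ + (m / (Real.sqrt (γ * ((Lfam : ℝ)⁻¹) ^ i)) ^ 2) / 2 * ‖y - x‖ ^ 2 ≤ V y)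
    (hZ : IntegrableOn (fun x => Real.exp (-V x)) Ωs)
    {A : Type*} (s : Finset A) (G : A → EuclideanSpace ℝ (Fin n) → ℝ) (B : A → ℝ) {L : ℝ} (hL : 0 < L)
    (hG : ∀ p ∈ s, ContDiff ℝ 1 (G p)) (hGb : ∀ p ∈ s, ∀ x, |G p x| ≤ B p) (hGD : ∀ p ∈ s, ∀ x, ‖fderiv ℝ (G p) x‖ ≤ L)
    {η : ℝ} (hη : 0 ≤ η)
    (hmean : ∀ p ∈ s, |∫ z, G p z ∂((volume.restrict Ωs).tilted fun x => -V x)| ≤ (1 - η) * θBal Lfam γ b₀ p₀ i) :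
    ((volume.restrict Ωs).tilted fun x => -V x).real {x | ∃ p ∈ s, θBal Lfam γ b₀ p₀ i ≤ |G p x|} ≤
      2 * s.card * Real.exp (-(m * η ^ 2 * B10.pFun b₀ p₀ (Real.sqrt (γ * ((Lfam : ℝ)⁻¹) ^ i)) ^ 2 / (2 * L ^ 2))) := by
  obtain ⟨hg, hp⟩ := coupling_pos_and_pFun_nonneg hLfam hγ hγ1 hb₀ p₀ i
  have hmean' : ∀ p ∈ s, |∫ z, G p z ∂((volume.restrict Ωs).tilted fun x => -V x)| ≤
      (1 - η) * (Real.sqrt (γ * ((Lfam : ℝ)⁻¹) ^ i) * B10.pFun b₀ p₀ (Real.sqrt (γ * ((Lfam : ℝ)⁻¹) ^ i))) := hmean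
  have h := convex_maxTail_box_of_centred_frac hΩo hΩc hΩ0 hm hg hVc hV hZ s G B hL hG hGb hGD hp hη hmean'
  have hexp : -(m * (η * B10.pFun b₀ p₀ (Real.sqrt (γ * ((Lfam : ℝ)⁻¹) ^ i))) ^ 2 / (2 * L ^ 2)) =
      -(m * η ^ 2 * B10.pFun b₀ p₀ (Real.sqrt (γ * ((Lfam : ℝ)⁻¹) ^ i)) ^ 2 / (2 * L ^ 2)) := by ring
  rw [hexp] at h
  exact h

/-- ★ **CONDITIONED-LAW WINDOW ODDS AT LEVEL `i`, η-CENTRED**: whole-space `(m∕g_i²)`-convex action conditioned on a convex set `Bx` of positive volume, means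
`≤ (1 − η)·θ_i` under `ν_B` ⇒ `≤ 2·#s·exp(−(m·η²)·pFun b₀ p₀ g_i²∕(2L²))`. [cite: Balaban1985UV3, (7) p.257 and (38)-(41) p.266; BobkovLedoux2000, remark p. 1038] -/
theorem convexWindowOdds_convexSet_le_frac {Bx : Set (EuclideanSpace ℝ (Fin n))} (hB : Convex ℝ Bx) (hB0 : volume Bx ≠ 0)
    {m : ℝ} (hm : 0 < m) {Lfam : ℕ} (hLfam : 1 ≤ Lfam) {γ b₀ : ℝ} (hγ : 0 < γ) (hγ1 : γ ≤ 1) (hb₀ : 0 ≤ b₀) (p₀ : ℝ) (i : ℕ)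
    (hVc : Continuous V)
    (hV : ∀ x y : EuclideanSpace ℝ (Fin n), V x + ⟪W x, y - x⟫ + (m / (Real.sqrt (γ * ((Lfam : ℝ)⁻¹) ^ i)) ^ 2) / 2 * ‖y - x‖ ^ 2 ≤ V y)
    (hZ : Integrable fun x => Real.exp (-V x))
    {A : Type*} (s : Finset A) (G : A → EuclideanSpace ℝ (Fin n) → ℝ) (B : A → ℝ) {L : ℝ} (hL : 0 < L)
    (hG : ∀ p ∈ s, ContDiff ℝ 1 (G p)) (hGb : ∀ p ∈ s, ∀ x, |G p x| ≤ B p) (hGD : ∀ p ∈ s, ∀ x, ‖fderiv ℝ (G p) x‖ ≤ L)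
    {η : ℝ} (hη : 0 ≤ η)
    (hmean : ∀ p ∈ s, |∫ z, G p z ∂((volume.restrict Bx).tilted fun x => -V x)| ≤ (1 - η) * θBal Lfam γ b₀ p₀ i) :
    ((volume.restrict Bx).tilted fun x => -V x).real {x | ∃ p ∈ s, θBal Lfam γ b₀ p₀ i ≤ |G p x|} ≤
      2 * s.card * Real.exp (-(m * η ^ 2 * B10.pFun b₀ p₀ (Real.sqrt (γ * ((Lfam : ℝ)⁻¹) ^ i)) ^ 2 / (2 * L ^ 2))) := by
  obtain ⟨hg, hp⟩ := coupling_pos_and_pFun_nonneg hLfam hγ hγ1 hb₀ p₀ i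
  have hmean' : ∀ p ∈ s, |∫ z, G p z ∂((volume.restrict Bx).tilted fun x => -V x)| ≤
      (1 - η) * (Real.sqrt (γ * ((Lfam : ℝ)⁻¹) ^ i) * B10.pFun b₀ p₀ (Real.sqrt (γ * ((Lfam : ℝ)⁻¹) ^ i))) := hmean
  have h := convex_maxTail_convexSet_of_centred_frac hB hB0 hm hg hVc hV hZ s G B hL hG hGb hGD hp hη hmean'
  have hexp : -(m * (η * B10.pFun b₀ p₀ (Real.sqrt (γ * ((Lfam : ℝ)⁻¹) ^ i))) ^ 2 / (2 * L ^ 2)) =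
      -(m * η ^ 2 * B10.pFun b₀ p₀ (Real.sqrt (γ * ((Lfam : ℝ)⁻¹) ^ i)) ^ 2 / (2 * L ^ 2)) := by ring
  rw [hexp] at h
  exact h

/-- ★ **BOX-LAW WINDOW ODDS AT LEVEL `i` FROM `StrongConvexOn`, η-CENTRED**: `StrongConvexOn Ω (m∕g_i²) V` + `ContinuousOn V Ω`, means `≤ (1 − η)·θ_i` under `ν_Ω` ⇒
`≤ 2·#s·exp(−(m·η²)·pFun b₀ p₀ g_i²∕(2L²))`. [cite: Balaban1985UV3, (7) p.257 and (38)-(41) p.266; BobkovLedoux2000, Prop. 3.1 p. 1034] -/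
theorem convexWindowOdds_box_le_of_strongConvexOn_frac {Ωs : Set (EuclideanSpace ℝ (Fin n))} (hΩo : IsOpen Ωs) (hΩc : Convex ℝ Ωs)
    (hΩ0 : volume Ωs ≠ 0) {m : ℝ} (hm : 0 < m) {Lfam : ℕ} (hLfam : 1 ≤ Lfam) {γ b₀ : ℝ} (hγ : 0 < γ) (hγ1 : γ ≤ 1) (hb₀ : 0 ≤ b₀)
    (p₀ : ℝ) (i : ℕ) (hVs : StrongConvexOn Ωs (m / (Real.sqrt (γ * ((Lfam : ℝ)⁻¹) ^ i)) ^ 2) V) (hVc : ContinuousOn V Ωs)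
    (hZ : IntegrableOn (fun x => Real.exp (-V x)) Ωs)
    {A : Type*} (s : Finset A) (G : A → EuclideanSpace ℝ (Fin n) → ℝ) (B : A → ℝ) {L : ℝ} (hL : 0 < L)
    (hG : ∀ p ∈ s, ContDiff ℝ 1 (G p)) (hGb : ∀ p ∈ s, ∀ x, |G p x| ≤ B p) (hGD : ∀ p ∈ s, ∀ x, ‖fderiv ℝ (G p) x‖ ≤ L)
    {η : ℝ} (hη : 0 ≤ η)
    (hmean : ∀ p ∈ s, |∫ z, G p z ∂((volume.restrict Ωs).tilted fun x => -V x)| ≤ (1 - η) * θBal Lfam γ b₀ p₀ i) :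
    ((volume.restrict Ωs).tilted fun x => -V x).real {x | ∃ p ∈ s, θBal Lfam γ b₀ p₀ i ≤ |G p x|} ≤
      2 * s.card * Real.exp (-(m * η ^ 2 * B10.pFun b₀ p₀ (Real.sqrt (γ * ((Lfam : ℝ)⁻¹) ^ i)) ^ 2 / (2 * L ^ 2))) := by
  obtain ⟨hg, hp⟩ := coupling_pos_and_pFun_nonneg hLfam hγ hγ1 hb₀ p₀ i
  have hmean' : ∀ p ∈ s, |∫ z, G p z ∂((volume.restrict Ωs).tilted fun x => -V x)| ≤
      (1 - η) * (Real.sqrt (γ * ((Lfam : ℝ)⁻¹) ^ i) * B10.pFun b₀ p₀ (Real.sqrt (γ * ((Lfam : ℝ)⁻¹) ^ i))) := hmean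
  have h := convex_maxTail_box_of_strongConvexOn_of_centred_frac hΩo hΩc hΩ0 hm hg hVs hVc hZ s G B hL hG hGb hGD hp hη hmean'
  have hexp : -(m * (η * B10.pFun b₀ p₀ (Real.sqrt (γ * ((Lfam : ℝ)⁻¹) ^ i))) ^ 2 / (2 * L ^ 2)) =
      -(m * η ^ 2 * B10.pFun b₀ p₀ (Real.sqrt (γ * ((Lfam : ℝ)⁻¹) ^ i)) ^ 2 / (2 * L ^ 2)) := by ring
  rw [hexp] at h
  exact h

end Profile

end Summit.QuantumFields.YangMills.Theorems.FluctuationComparisonRegPrIntLTailSupOneConvexTailEta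

end
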